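import Literature.AnabelianGeometry.Anabelioids.Basic
import Mathlib.CategoryTheory.Galois.Full
import HarnessLib

/-!
# Anabelioids: proofs of named facts of `Anabelioids/Basic.lean`, II — `automorphisms_of_arrow` ([GeoAn] Cor. 1.1.6)

Mochizuki, *The geometry of anabelioids*, Publ. RIMS **40** (2004), §1.1, Corollary 1.1.6
(Automorphisms of an Arrow Between Connected Anabelioids), author's manuscript p. 14
[cite: MochizukiGeoAn2004, Cor. 1.1.6 p.14]: "The set of automorphisms `Aut(X → Y)` of a 1-arrow
between connected anabelioids is in natural bijective correspondence with the centralizer in the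
fundamental group of `Y` of the image of the fundamental group of `X`", rendered in the statement
file `Literature.AnabelianGeometry.Anabelioids.Basic` as the named fact `automorphisms_of_arrow`:
for `φ : X → Y` (an exact functor `φ^* : Y ⥤ X`) and a basepoint `β` of `X` (fibre functor `F`),
`Aut(φ) ≃ Z_{π₁(Y, φ ∘ β)}(π₁(φ)(π₁(X, β)))` with `π₁(Y, φ ∘ β) = Aut(φ^* ⋙ F)`.

Proof (`automorphisms_of_arrow_holds`). An automorphism `α : φ^* ≅ φ^*` gives the automorphism
`α ⋆ F` of `φ^* ⋙ F` (whiskering), which commutes with every `π₁(φ)(σ) = σ ⋆ φ^*` by naturality of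
`σ : F ≅ F`; the map is injective because the fibre functor is faithful, and surjective because, by
Mathlib's FULL FAITHFULNESS of `PreGaloisCategory.functorToAction F : X ⥤ Aut(F)-FinSets`
(the fundamental theorem of Galois categories, SGA1 V), a component `τ_B : F(φ^* B) ≅ F(φ^* B)`
commuting with all `σ_{φ^* B}` is an `Aut(F)`-equivariant isomorphism, hence `F` of a unique
isomorphism `α_B : φ^* B ≅ φ^* B`, natural in `B` by faithfulness. Automorphisms of `φ` in the
category `Y ⥤ₑ X` of exact functors are the automorphisms of `φ^*` (full subcategory).

Proof-only companion (second file; `BasicProofs.lean` holds `bCat_galoisCategory`): no definitions,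
nothing of the statement file is restated.
-/

namespace Literature.AnabelianGeometry.Anabelioids

open CategoryTheory CategoryTheory.Limits CategoryTheory.PreGaloisCategory

universe v₁ v₂ u₁ u₂

section

variable {X : Type u₁} [Category.{v₁} X] {Y : Type u₂} [Category.{v₂} Y]

/-- Components of a product in `Aut(Z)`: `(g * w)_B = w_B ≫ g_B`. [folklore] -/
private theorem aut_mul_hom_app {D : Type u₂} [Category.{v₂} D] {Z : X ⥤ D} (g w : Aut Z) (A : X) :
    (g * w).hom.app A = w.hom.app A ≫ g.hom.app A :=
  rfl

/-- An automorphism `w` of `P ⋙ F` with components `F(α_B)` (`α` an automorphism of `P`) lies in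
the centralizer of `π₁(P)(Aut F)` (naturality of `σ ∈ Aut F` at `α_B`). [folklore] -/
private theorem mem_centralizer_of_app_eq (P : Y ⥤ X) (F : X ⥤ FintypeCat.{v₁}) (α : P ≅ P)
    (w : Aut (P ⋙ F)) (hw : ∀ B, w.hom.app B = F.map (α.hom.app B)) :
    w ∈ Subgroup.centralizer (Set.range (pi1Map P F)) := by
  rw [Subgroup.mem_centralizer_iff]
  rintro _ ⟨σ, rfl⟩
  apply Iso.ext
  apply NatTrans.ext
  funext B
  rw [aut_mul_hom_app, aut_mul_hom_app, pi1Map_hom_app, hw]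
  exact σ.hom.naturality (α.hom.app B)

/-- The whiskered automorphism `α ⋆ F` has components `F(α_B)`. [folklore] -/
private theorem isoWhiskerRight_hom_app' (P : Y ⥤ X) (F : X ⥤ FintypeCat.{v₁}) (α : P ≅ P) (B : Y) :
    (Functor.isoWhiskerRight α F).hom.app B = F.map (α.hom.app B) := by
  rw [Functor.isoWhiskerRight_hom, Functor.whiskerRight_app]

/-- Injectivity of `α ↦ α ⋆ F` for a faithful `F`. [folklore] -/
private theorem isoWhiskerRight_injective (P : Y ⥤ X) (F : X ⥤ FintypeCat.{v₁}) [F.Faithful] :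
    Function.Injective fun α : P ≅ P => Functor.isoWhiskerRight α F := by
  intro α α' h
  apply Iso.ext
  apply NatTrans.ext
  funext B
  have hB := congrArg (fun e : P ⋙ F ≅ P ⋙ F => e.hom.app B) h
  simp only [Functor.isoWhiskerRight_hom, Functor.whiskerRight_app] at hB
  exact F.map_injective hB

/-- Surjectivity onto the centralizer: a `τ ∈ Aut(P ⋙ F)` commuting with all `σ ⋆ P` is
`Aut(F)`-equivariant componentwise, hence the image of a (unique) `α : P ≅ P` under the fully
faithful `functorToAction F` (Mathlib, SGA1 V.4), natural by faithfulness. [folklore] -/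
private theorem exists_isoWhiskerRight_eq [GaloisCategory X] (P : Y ⥤ X)
    (F : X ⥤ FintypeCat.{v₁}) [FiberFunctor F] (τ : Aut (P ⋙ F))
    (hτ : τ ∈ Subgroup.centralizer (Set.range (pi1Map P F))) :
    ∃ α : P ≅ P, Functor.isoWhiskerRight α F = τ := by
  rw [Subgroup.mem_centralizer_iff] at hτ
  -- componentwise commutation with `σ_{P B}`
  have hcomm : ∀ (B : Y) (σ : Aut F),
      τ.hom.app B ≫ σ.hom.app (P.obj B) = σ.hom.app (P.obj B) ≫ τ.hom.app B := by
    intro B σ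
    have h := congrArg (fun e : Aut (P ⋙ F) => e.hom.app B) (hτ _ ⟨σ, rfl⟩)
    simp only [aut_mul_hom_app, pi1Map_hom_app] at h
    exact h
  -- the equivariant isomorphisms and their preimages under the fully faithful `functorToAction F`
  let hF : (functorToAction F).FullyFaithful := Functor.FullyFaithful.ofFullyFaithful _
  let e : ∀ B : Y, (functorToAction F).obj (P.obj B) ≅ (functorToAction F).obj (P.obj B) :=
    fun B => Action.mkIso (τ.app B) fun σ => by
      ext x
      exact (ConcreteCategory.congr_hom (hcomm B σ) x).symm
  let a : ∀ B : Y, P.obj B ≅ P.obj B := fun B => hF.preimageIso (e B)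
  have ha : ∀ B : Y, F.map (a B).hom = τ.hom.app B := fun B => by
    have h1 : (functorToAction F).map (a B).hom = (e B).hom := hF.map_preimage _
    exact congrArg Action.Hom.hom h1
  -- naturality, by faithfulness of `F` and naturality of `τ`
  have hnat : ∀ {B B' : Y} (f : B ⟶ B'), P.map f ≫ (a B').hom = (a B).hom ≫ P.map f := by
    intro B B' f
    apply F.map_injective
    rw [F.map_comp, F.map_comp, ha, ha]
    exact τ.hom.naturality f
  refine ⟨NatIso.ofComponents a hnat, ?_⟩
  apply Iso.ext
  apply NatTrans.ext
  funext B
  rw [Functor.isoWhiskerRight_hom, Functor.whiskerRight_app]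
  exact ha B

end

/-- NAMED FACT `automorphisms_of_arrow` = [GeoAn] Corollary 1.1.6, PROVED: for a morphism
`φ : X → Y` of connected anabelioids and a basepoint `β` of `X`,
`Aut(φ) ≃ Z_{π₁(Y, φ∘β)}(Im π₁(X, β))` — whiskering with the fibre functor, bijective by the full
faithfulness of `X ⥤ Aut(β)-FinSets` (Mathlib `PreGaloisCategory.functorToAction`).
[cite: MochizukiGeoAn2004, Cor. 1.1.6 p.14] -/
theorem automorphisms_of_arrow_holds : automorphisms_of_arrow.{v₁, v₂, u₁, u₂} := by
  intro X _ Y _ _ _ φ F _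
  -- automorphisms in the full subcategory of exact functors = automorphisms of the functor
  let e₁ : (φ ≅ φ) ≃ (φ.pullback ≅ φ.pullback) := ((exactFunctor Y X).fullyFaithfulι).isoEquiv
  let f : (φ.pullback ≅ φ.pullback) → Subgroup.centralizer (Set.range (pi1Map φ.pullback F)) :=
    fun α => ⟨Functor.isoWhiskerRight α F,
      mem_centralizer_of_app_eq φ.pullback F α _ (isoWhiskerRight_hom_app' φ.pullback F α)⟩
  have hf : Function.Bijective f := by
    constructor
    · intro α α' h
      exact isoWhiskerRight_injective φ.pullback F (congrArg Subtype.val h)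
    · rintro ⟨τ, hτ⟩
      obtain ⟨α, hα⟩ := exists_isoWhiskerRight_eq φ.pullback F τ hτ
      exact ⟨α, Subtype.ext hα⟩
  exact ⟨e₁.trans (Equiv.ofBijective f hf)⟩

end Literature.AnabelianGeometry.Anabelioids
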